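import Mathlib
import Literature.MathematicalPhysics.QuantumFieldTheory.Luscher2010.TrivializingMaps
import Literature.Analysis.ODE.CompactSupportFlow
import Literature.Analysis.FunctionSpaces.SmoothParametricIntegral
import Summits.Ventures.LatticeQCDFlow.TrivializingMaps.TruncationDefect
import Summits.Ventures.LatticeQCDFlow.TrivializingMaps.DefectLogWeight

/-!
# LatticeQCDFlow / TrivializingMaps — transport along the cut-off ambient flow (for the Jacobian formula)

HONEST FRAMING: exact (Metropolis-corrected) sampling algorithms for lattice gauge theory; figures
of merit are autocorrelation/cost numbers at stated couplings and volumes; no continuum-physics claim.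

Venture `LatticeQCDFlow` (cell pub-lqcd), topic `TrivializingMaps`, row 31 (lean-2). The flow-side
input of the Jacobian formula (Lüscher 2010 eq. (3.9)), assembled in `JacobianFormula.lean`:

* `tcut`, `pcut`, `cutField`, `cutDiv` — smooth cut-offs in time and in the ambient configuration
  (both equal to `1` on `[-T, T] × SU(n)^E`) of the ambient field `(τ, W) ↦ (Z_τ(W)(e) W(e))_e` and of
  the divergence `(τ, W) ↦ div Z_τ (W)`; the cut-off field is `C¹` with compact support, so the tree's
  time-dependent flow `Literature.Analysis.ODE.tdFlow` (jointly `C¹` evolution maps, Chapman–Kolmogorov,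
  uniqueness) applies: `cutFlow`;
* `cutFlow_eq_coeConfig` — on `(-T, T)` the cut-off flow through `SU(n)^E` IS the given flow map `Φ`;
* `logJac`, `transportFn` — the log-Jacobian `Y_s(W) = ∫_s^{t₀} d̃iv(r, Ψ_{s→r} W) dr` and the transported
  observable `U(s, W) = Õ(Ψ_{s→t₀} W) · e^{Y_s(W)}`, jointly `C¹` in `(s, W)` (parametric interval
  integrals, `Literature.Analysis.FunctionSpaces.hasFDerivAt_parametric_intervalIntegral`);
* `fderiv_transportFn_apply_one_cutField` — the **transport identity**
  `DU(s, W)[(1, X(s, W))] = -d̃iv(s, W) · U(s, W)` (Chapman–Kolmogorov + additivity of the integral +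
  the chain rule), which on `SU(n)^E` reads `∂_s U + Z_s·∇U + (div Z_s) U = 0`.

All elementary ([folklore]) given the tree's ODE library. -/

noncomputable section

open MeasureTheory Matrix Set Filter Function Metric intervalIntegral
open scoped Matrix Topology NNReal

namespace Summit.Ventures.LatticeQCDFlow.TrivializingMaps

open Literature.MathematicalPhysics.QuantumFieldTheory
open Literature.MathematicalPhysics.QuantumFieldTheory.Luscher2010
open Literature.MathematicalPhysics.QuantumFieldTheory.WilsonFlow
open Literature.Analysis.ODE
open scoped Matrix.Norms.Frobenius ContDiff

variable {d L n : ℕ}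

/-! ## §1. Cut-offs -/

section Cutoffs

/-- Smooth time cut-off: `1` on `[-T, T]`, `0` outside `[-T-1, T+1]`. [folklore] -/
def tcut (T τ : ℝ) : ℝ := Real.smoothTransition (T + 1 - τ) * Real.smoothTransition (T + 1 + τ)

/-- `tcut T = 1` on `[-T, T]`. [folklore] -/
theorem tcut_eq_one {T τ : ℝ} (h : |τ| ≤ T) : tcut T τ = 1 := by
  unfold tcut
  rw [Real.smoothTransition.one_of_one_le (by linarith [le_abs_self τ]),
    Real.smoothTransition.one_of_one_le (by linarith [neg_abs_le τ]), one_mul]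

/-- `tcut T = 0` outside `[-T-1, T+1]`. [folklore] -/
theorem tcut_eq_zero {T τ : ℝ} (h : T + 1 ≤ |τ|) : tcut T τ = 0 := by
  unfold tcut
  rcases le_or_gt 0 τ with hτ | hτ
  · rw [abs_of_nonneg hτ] at h
    rw [Real.smoothTransition.zero_of_nonpos (by linarith), zero_mul]
  · rw [abs_of_neg hτ] at h
    rw [Real.smoothTransition.zero_of_nonpos (x := T + 1 + τ) (by linarith), mul_zero]

/-- The time cut-off is smooth. [folklore] -/
theorem contDiff_tcut (T : ℝ) {m : ℕ∞} : ContDiff ℝ m (tcut T) := by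
  unfold tcut
  exact (Real.smoothTransition.contDiff.comp (contDiff_const.sub contDiff_id)).mul
    (Real.smoothTransition.contDiff.comp (contDiff_const.add contDiff_id))

variable [NeZero L]

/-- The joint scalar cut-off `ω_T(τ, W) = tcut_T(τ) · χ(W)` (`χ` = `WilsonFlow.cutoff`). [folklore] -/
def pcut (T : ℝ) (p : ℝ × AmbConfig d L n) : ℝ := tcut T p.1 * cutoff p.2

/-- The joint cut-off is smooth. [folklore] -/
theorem contDiff_pcut (T : ℝ) {m : ℕ∞} : ContDiff ℝ m (pcut (d := d) (L := L) (n := n) T) :=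
  ((contDiff_tcut T).comp contDiff_fst).mul ((contDiff_cutoff (m := m)).comp contDiff_snd)

/-- The joint cut-off equals `1` on `[-T, T] × SU(n)^E`. [folklore] -/
theorem pcut_eq_one {T τ : ℝ} (h : |τ| ≤ T) (U : GaugeConfig d L (Matrix.specialUnitaryGroup (Fin n) ℂ)) :
    pcut T (τ, coeConfig U) = 1 := by
  unfold pcut
  rw [tcut_eq_one h, cutoff_eq_one ((sqNorm_coeConfig_le U).trans (by linarith)), one_mul]

/-- The joint cut-off has compact support in `ℝ × M_n(ℂ)^E`. [folklore] -/
theorem hasCompactSupport_pcut (T : ℝ) : HasCompactSupport (pcut (d := d) (L := L) (n := n) T) := by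
  obtain ⟨K, hK, hKz⟩ : ∃ K : Set (AmbConfig d L n), IsCompact K ∧ ∀ W ∉ K, cutoff W = 0 := by
    refine ⟨tsupport (cutoff (d := d) (L := L) (n := n)), hasCompactSupport_cutoff, fun W hW => ?_⟩
    exact image_eq_zero_of_notMem_tsupport hW
  refine HasCompactSupport.intro ((isCompact_Icc (a := -(T + 1)) (b := T + 1)).prod hK) fun p hp => ?_
  rw [mem_prod, not_and_or] at hp
  unfold pcut
  rcases hp with h1 | h2
  · rw [mem_Icc, not_and_or, not_le, not_le] at h1
    have : T + 1 ≤ |p.1| := by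
      rcases h1 with h | h
      · linarith [neg_le_abs p.1]
      · linarith [le_abs_self p.1]
    rw [tcut_eq_zero this, zero_mul]
  · rw [hKz p.2 h2, mul_zero]

end Cutoffs

/-! ## §2. The cut-off field, the cut-off divergence and the ambient two-time flow -/

section Field

variable [NeZero L]

/-- The cut-off ambient field `X_T(τ, W) = ω_T(τ, W) · (Z_τ(W)(e) W(e))_e`. [folklore] -/
def cutField (Z : Generator d L n) (T : ℝ) (p : ℝ × AmbConfig d L n) : AmbConfig d L n :=
  pcut T p • fun e => Z p.1 p.2 e * p.2 e

/-- The cut-off divergence `d̃iv_T(τ, W) = ω_T(τ, W) · (div Z_τ)(W)`. [folklore] -/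
def cutDiv (B : SuBasis n) (Z : Generator d L n) (T : ℝ) (p : ℝ × AmbConfig d L n) : ℝ :=
  pcut T p * linkDiv B (Z p.1) p.2

/-- On `[-T, T] × SU(n)^E` the cut-off field is the true field `(Z_τ(U)(e) U(e))_e`. [folklore] -/
theorem cutField_eq_of_abs_le (Z : Generator d L n) {T τ : ℝ} (h : |τ| ≤ T)
    (U : GaugeConfig d L (Matrix.specialUnitaryGroup (Fin n) ℂ)) :
    cutField Z T (τ, coeConfig U) = fun e => Z τ (coeConfig U) e * coeConfig U e := by
  unfold cutField
  rw [pcut_eq_one h U, one_smul]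

/-- On `[-T, T] × SU(n)^E` the cut-off divergence is `div Z_τ`. [folklore] -/
theorem cutDiv_eq_of_abs_le (B : SuBasis n) (Z : Generator d L n) {T τ : ℝ} (h : |τ| ≤ T)
    (U : GaugeConfig d L (Matrix.specialUnitaryGroup (Fin n) ℂ)) :
    cutDiv B Z T (τ, coeConfig U) = linkDiv B (Z τ) (coeConfig U) := by
  unfold cutDiv
  rw [pcut_eq_one h U, one_mul]

/-- The cut-off field is `C¹` when the generator is. [folklore] -/
theorem contDiff_cutField {Z : Generator d L n} (hZ : ContDiff ℝ 1 fun p : ℝ × AmbConfig d L n => Z p.1 p.2)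
    (T : ℝ) : ContDiff ℝ 1 (cutField Z T) := by
  unfold cutField
  refine (contDiff_pcut T (m := 1)).smul (contDiff_pi.2 fun e => ?_)
  exact ((contDiff_apply ℝ _ e).comp hZ).mul ((contDiff_apply ℝ _ e).comp contDiff_snd)

/-- The cut-off field has compact support. [folklore] -/
theorem hasCompactSupport_cutField (Z : Generator d L n) (T : ℝ) :
    HasCompactSupport (cutField Z T) :=
  (hasCompactSupport_pcut T).smul_right

/-- `∂_{e,X}` lowers joint regularity in `(τ, W)` by one: `C²` families have `C¹` link derivatives
(finite-order form of `contDiff_linkDeriv_param`). [folklore] -/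
theorem contDiff_one_linkDeriv_param {F : ℝ → AmbConfig d L n → ℝ}
    (hF : ContDiff ℝ 2 fun p : ℝ × AmbConfig d L n => F p.1 p.2) (e : Edge d L)
    (X : Matrix (Fin n) (Fin n) ℂ) :
    ContDiff ℝ 1 fun p : ℝ × AmbConfig d L n => linkDeriv e X (F p.1) p.2 := by
  have h20 : (2 : WithTop ℕ∞) ≠ 0 := by norm_num
  have h12 : (1 : WithTop ℕ∞) + 1 ≤ 2 := by norm_num
  have hsl : ∀ t, ContDiff ℝ 2 (F t) := fun t => hF.comp (contDiff_const.prodMk contDiff_id)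
  have heq : (fun p : ℝ × AmbConfig d L n => linkDeriv e X (F p.1) p.2) =
      fun p => fderiv ℝ (F p.1) p.2 (Pi.single e (X * p.2 e)) :=
    funext fun p => linkDeriv_eq_fderiv ((hsl p.1).differentiable h20 p.2) e X
  rw [heq]
  have hunc : ContDiff ℝ 2
      (Function.uncurry fun (p : ℝ × AmbConfig d L n) (W : AmbConfig d L n) => F p.1 W) :=
    hF.comp ((contDiff_fst.comp contDiff_fst).prodMk contDiff_snd)
  have hv : ContDiff ℝ 1 fun p : ℝ × AmbConfig d L n => (Pi.single e (X * p.2 e) : AmbConfig d L n) :=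
    ((contDiff_pi_single_mul_apply (d := d) (L := L) (n := n) e X).of_le
      (by exact_mod_cast le_top)).comp contDiff_snd
  exact hunc.fderiv_apply contDiff_snd hv h12

/-- **The divergence of a `C²` generator is `C¹` jointly in `(τ, W)`.** [folklore] -/
theorem contDiff_one_linkDiv_param (B : SuBasis n) {Z : Generator d L n}
    (hZ : ContDiff ℝ 2 fun p : ℝ × AmbConfig d L n => Z p.1 p.2) :
    ContDiff ℝ 1 fun p : ℝ × AmbConfig d L n => linkDiv B (Z p.1) p.2 := by
  unfold linkDiv
  refine ContDiff.sum fun e _ => ContDiff.sum fun a _ => ?_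
  have hcoord : ContDiff ℝ 2 (fun M : Matrix (Fin n) (Fin n) ℂ => B.coord a M) := by
    unfold SuBasis.coord
    refine contDiff_const.mul ?_
    exact Complex.reCLM.contDiff.comp (contDiff_trace.comp (contDiff_const.mul contDiff_id))
  exact contDiff_one_linkDeriv_param (F := fun τ W => B.coord a (Z τ W e))
    (hcoord.comp ((contDiff_apply ℝ _ e).comp hZ)) e (B.T a)

/-- The cut-off divergence is `C¹` for a `C²` generator. [folklore] -/
theorem contDiff_cutDiv (B : SuBasis n) {Z : Generator d L n}
    (hZ : ContDiff ℝ 2 fun p : ℝ × AmbConfig d L n => Z p.1 p.2) (T : ℝ) :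
    ContDiff ℝ 1 (cutDiv B Z T) := by
  unfold cutDiv
  exact (contDiff_pcut T (m := 1)).mul (contDiff_one_linkDiv_param B hZ)

/-- **The ambient two-time flow** `Ψ_{s→t}` of the cut-off field (the tree's `tdFlow`: jointly `C¹`,
Chapman–Kolmogorov, transports every solution). [folklore] -/
def cutFlow {Z : Generator d L n} (hZ : ContDiff ℝ 1 fun p : ℝ × AmbConfig d L n => Z p.1 p.2) (T : ℝ) :
    ℝ → ℝ → AmbConfig d L n → AmbConfig d L n :=
  tdFlow (contDiff_cutField hZ T) (hasCompactSupport_cutField Z T) le_rfl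

variable {Z : Generator d L n} (hZ : ContDiff ℝ 1 fun p : ℝ × AmbConfig d L n => Z p.1 p.2) (T : ℝ)

/-- Joint `C¹` smoothness of `(s, t, W) ↦ Ψ_{s→t} W`. [folklore] -/
theorem contDiff_cutFlow : ContDiff ℝ 1 fun p : ℝ × ℝ × AmbConfig d L n => cutFlow hZ T p.1 p.2.1 p.2.2 :=
  contDiff_tdFlow _ _ _

/-- `Ψ_{s→s} = id`. [folklore] -/
@[simp] theorem cutFlow_self (s : ℝ) (W : AmbConfig d L n) : cutFlow hZ T s s W = W := tdFlow_self _ _ _ s W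

/-- `t ↦ Ψ_{s→t} W` solves the cut-off equation. [folklore] -/
theorem hasDerivAt_cutFlow (s : ℝ) (W : AmbConfig d L n) (t : ℝ) :
    HasDerivAt (fun t => cutFlow hZ T s t W) (cutField Z T (t, cutFlow hZ T s t W)) t :=
  hasDerivAt_tdFlow _ _ _ s W t

/-- Chapman–Kolmogorov: `Ψ_{t₁→t₂} ∘ Ψ_{t₀→t₁} = Ψ_{t₀→t₂}`. [folklore] -/
theorem cutFlow_trans (t₀ t₁ t₂ : ℝ) (W : AmbConfig d L n) :
    cutFlow hZ T t₁ t₂ (cutFlow hZ T t₀ t₁ W) = cutFlow hZ T t₀ t₂ W :=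
  tdFlow_trans _ _ _ t₀ t₁ t₂ W

/-- **On `(-T, T)` the cut-off flow through `SU(n)^E` is the flow map of the generator**: for
`IsFlowMap Z Φ`, `Ψ_{0→r}(U) = Φ_r(U)` for `|r| < T` (both solve the true flow equation there, where the
cut-offs are inactive; uniqueness). [cite: Luscher2010Trivializing, §3.1 eq. (3.2)] -/
theorem cutFlow_eq_coeConfig {Φ : ℝ → GaugeConfig d L (Matrix.specialUnitaryGroup (Fin n) ℂ) →
      GaugeConfig d L (Matrix.specialUnitaryGroup (Fin n) ℂ)} (hΦ : IsFlowMap Z Φ) (hT : 0 < T)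
    (U : GaugeConfig d L (Matrix.specialUnitaryGroup (Fin n) ℂ)) {r : ℝ} (hr : r ∈ Ioo (-T) T) :
    cutFlow hZ T 0 r (coeConfig U) = coeConfig (Φ r U) := by
  have hγ : ∀ t ∈ Ioo (-T) T, HasDerivAt (fun t => coeConfig (Φ t U))
      (cutField Z T (t, coeConfig (Φ t U))) t := by
    intro t ht
    have h := isFlowLine_hasDerivAt_amb (hΦ.2 U) t
    rw [cutField_eq_of_abs_le Z (abs_le.2 ⟨ht.1.le, ht.2.le⟩)]
    exact h
  have h := tdFlow_eq_of_hasDerivAt (contDiff_cutField hZ T) (hasCompactSupport_cutField Z T) le_rfl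
    (γ := fun t => coeConfig (Φ t U)) (t₀ := 0) ⟨by linarith, hT⟩ hγ hr
  simp only [hΦ.1 U] at h
  exact h

end Field

/-! ## §3. The log-Jacobian and the transported observable -/

section Transport

variable [NeZero L]

/-- `C¹` dependence on parameters of interval integrals (the tree's
`hasFDerivAt_parametric_intervalIntegral`, plus continuity of the derivative). [folklore] -/
theorem contDiff_one_parametric_intervalIntegral {P : Type*} [NormedAddCommGroup P] [NormedSpace ℝ P]
    [FiniteDimensional ℝ P] {H : ℝ × P → ℝ} (hH : ContDiff ℝ 1 H) (a b : ℝ) :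
    ContDiff ℝ 1 fun p : P => ∫ σ in a..b, H (σ, p) := by
  rw [contDiff_one_iff_fderiv]
  refine ⟨fun p => (Literature.Analysis.FunctionSpaces.hasFDerivAt_parametric_intervalIntegral hH
    one_ne_zero a b p).differentiableAt, ?_⟩
  have heq : (fderiv ℝ fun p : P => ∫ σ in a..b, H (σ, p)) =
      fun p => ∫ σ in a..b, (fderiv ℝ H (σ, p)).comp (ContinuousLinearMap.inr ℝ ℝ P) :=
    funext fun p => (Literature.Analysis.FunctionSpaces.hasFDerivAt_parametric_intervalIntegral hH
      one_ne_zero a b p).fderiv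
  rw [heq]
  have hc : Continuous (Function.uncurry fun (p : P) (σ : ℝ) =>
      (fderiv ℝ H (σ, p)).comp (ContinuousLinearMap.inr ℝ ℝ P)) := by
    have h1 : Continuous fun q : P × ℝ => fderiv ℝ H (q.2, q.1) :=
      (hH.continuous_fderiv one_ne_zero).comp (continuous_snd.prodMk continuous_fst)
    exact h1.clm_comp continuous_const
  exact intervalIntegral.continuous_parametric_intervalIntegral_of_continuous' hc a b

variable (B : SuBasis n) {Z : Generator d L n}
  (hZ1 : ContDiff ℝ 1 fun p : ℝ × AmbConfig d L n => Z p.1 p.2) (T t₀ : ℝ)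

/-- **The log-Jacobian** along the cut-off flow: `Y_s(W) = ∫_s^{t₀} d̃iv(r, Ψ_{s→r} W) dr` (the exponent
of eq. (3.9), read backwards from the target time `t₀`). [cite: Luscher2010Trivializing, §3.2 eq. (3.9)] -/
def logJac (s : ℝ) (W : AmbConfig d L n) : ℝ :=
  ∫ r in s..t₀, cutDiv B Z T (r, cutFlow hZ1 T s r W)

/-- The integrand of the log-Jacobian is continuous in `r`. [folklore] -/
theorem continuous_cutDiv_cutFlow (hZ2 : ContDiff ℝ 2 fun p : ℝ × AmbConfig d L n => Z p.1 p.2) (s : ℝ) (W : AmbConfig d L n) :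
    Continuous fun r => cutDiv B Z T (r, cutFlow hZ1 T s r W) :=
  (contDiff_cutDiv B hZ2 T).continuous.comp (continuous_id.prodMk
    ((contDiff_cutFlow hZ1 T).continuous.comp
      (continuous_const.prodMk (continuous_id.prodMk continuous_const))))

/-- The log-Jacobian after the affine substitution `r = s + ρ (t₀ - s)`: an integral over `[0, 1]` of a
jointly `C¹` integrand. [folklore] -/
theorem logJac_eq_integral_unit (s : ℝ) (W : AmbConfig d L n) :
    logJac B hZ1 T t₀ s W = ∫ ρ in (0 : ℝ)..1,
      (t₀ - s) * cutDiv B Z T ((t₀ - s) * ρ + s, cutFlow hZ1 T s ((t₀ - s) * ρ + s) W) := by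
  unfold logJac
  have h := intervalIntegral.smul_integral_comp_mul_add
    (f := fun r => cutDiv B Z T (r, cutFlow hZ1 T s r W)) (a := 0) (b := 1) (t₀ - s) s
  rw [mul_zero, zero_add, mul_one, sub_add_cancel] at h
  rw [← h, ← intervalIntegral.integral_smul]
  rfl

/-- **The log-Jacobian is jointly `C¹` in `(s, W)`** (for a `C²` generator). [folklore] -/
theorem contDiff_logJac (hZ2 : ContDiff ℝ 2 fun p : ℝ × AmbConfig d L n => Z p.1 p.2) :
    ContDiff ℝ 1 fun q : ℝ × AmbConfig d L n => logJac B hZ1 T t₀ q.1 q.2 := by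
  have heq : (fun q : ℝ × AmbConfig d L n => logJac B hZ1 T t₀ q.1 q.2) = fun q => ∫ ρ in (0 : ℝ)..1,
      (t₀ - q.1) * cutDiv B Z T ((t₀ - q.1) * ρ + q.1, cutFlow hZ1 T q.1 ((t₀ - q.1) * ρ + q.1) q.2) :=
    funext fun q => logJac_eq_integral_unit B hZ1 T t₀ q.1 q.2
  rw [heq]
  -- the integrand `(ρ, (s, W)) ↦ (t₀ - s) d̃iv((t₀-s)ρ+s, Ψ_{s→(t₀-s)ρ+s} W)` is `C¹`
  have htime : ContDiff ℝ 1 fun y : ℝ × (ℝ × AmbConfig d L n) => (t₀ - y.2.1) * y.1 + y.2.1 :=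
    ((contDiff_const.sub (contDiff_fst.comp contDiff_snd)).mul contDiff_fst).add
      (contDiff_fst.comp contDiff_snd)
  have hflow : ContDiff ℝ 1 fun y : ℝ × (ℝ × AmbConfig d L n) =>
      cutFlow hZ1 T y.2.1 ((t₀ - y.2.1) * y.1 + y.2.1) y.2.2 :=
    (contDiff_cutFlow hZ1 T).comp ((contDiff_fst.comp contDiff_snd).prodMk
      (htime.prodMk (contDiff_snd.comp contDiff_snd)))
  have hH : ContDiff ℝ 1 fun y : ℝ × (ℝ × AmbConfig d L n) =>
      (t₀ - y.2.1) * cutDiv B Z T ((t₀ - y.2.1) * y.1 + y.2.1,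
        cutFlow hZ1 T y.2.1 ((t₀ - y.2.1) * y.1 + y.2.1) y.2.2) :=
    (contDiff_const.sub (contDiff_fst.comp contDiff_snd)).mul
      ((contDiff_cutDiv B hZ2 T).comp (htime.prodMk hflow))
  exact contDiff_one_parametric_intervalIntegral hH 0 1

/-- **The transported observable** `U(s, W) = Õ(Ψ_{s→t₀} W) · exp Y_s(W)`.
[cite: Luscher2010Trivializing, §3.2 eq. (3.9)] -/
def transportFn (O : AmbConfig d L n → ℝ) (q : ℝ × AmbConfig d L n) : ℝ :=
  O (cutFlow hZ1 T q.1 t₀ q.2) * Real.exp (logJac B hZ1 T t₀ q.1 q.2)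

/-- The transported observable is jointly `C¹`. [folklore] -/
theorem contDiff_transportFn (hZ2 : ContDiff ℝ 2 fun p : ℝ × AmbConfig d L n => Z p.1 p.2)
    {O : AmbConfig d L n → ℝ} (hO : ContDiff ℝ 1 O) :
    ContDiff ℝ 1 (transportFn B hZ1 T t₀ O) := by
  unfold transportFn
  refine (hO.comp ?_).mul (Real.contDiff_exp.comp (contDiff_logJac B hZ1 T t₀ hZ2))
  exact (contDiff_cutFlow hZ1 T).comp (contDiff_fst.prodMk (contDiff_const.prodMk contDiff_snd))

/-- At the target time the transported observable is the observable: `U(t₀, W) = Õ(W)`. [folklore] -/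
theorem transportFn_self (O : AmbConfig d L n → ℝ) (W : AmbConfig d L n) :
    transportFn B hZ1 T t₀ O (t₀, W) = O W := by
  simp [transportFn, logJac, cutFlow_self, intervalIntegral.integral_same]

/-- Along the flow line `σ ↦ (s + σ, Ψ_{s→s+σ} W)` the transported observable changes only through the
log-Jacobian: `U(s+σ, Ψ_{s→s+σ} W) = U(s, W) · exp(-∫_s^{s+σ} d̃iv(r, Ψ_{s→r} W) dr)`
(Chapman–Kolmogorov and additivity of the integral). [folklore] -/
theorem transportFn_flowLine (hZ2 : ContDiff ℝ 2 fun p : ℝ × AmbConfig d L n => Z p.1 p.2)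
    (O : AmbConfig d L n → ℝ) (s : ℝ) (W : AmbConfig d L n) (σ : ℝ) :
    transportFn B hZ1 T t₀ O (s + σ, cutFlow hZ1 T s (s + σ) W) =
      transportFn B hZ1 T t₀ O (s, W) *
        Real.exp (-∫ r in s..s + σ, cutDiv B Z T (r, cutFlow hZ1 T s r W)) := by
  unfold transportFn logJac
  simp only [cutFlow_trans]
  have hint : ∀ a b, IntervalIntegrable (fun r => cutDiv B Z T (r, cutFlow hZ1 T s r W)) volume a b :=
    fun a b => (continuous_cutDiv_cutFlow B hZ1 T hZ2 s W).intervalIntegrable a b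
  have hsplit : ∫ r in s + σ..t₀, cutDiv B Z T (r, cutFlow hZ1 T s r W) =
      (∫ r in s..t₀, cutDiv B Z T (r, cutFlow hZ1 T s r W)) -
        ∫ r in s..s + σ, cutDiv B Z T (r, cutFlow hZ1 T s r W) := by
    rw [eq_sub_iff_add_eq, add_comm, intervalIntegral.integral_add_adjacent_intervals (hint _ _) (hint _ _)]
  rw [hsplit, sub_eq_add_neg, Real.exp_add, mul_assoc]

/-- **The transport identity**: `DU(s, W)[(1, X_T(s, W))] = -d̃iv_T(s, W) · U(s, W)` at every `(s, W)`
(differentiate `transportFn_flowLine` at `σ = 0`). On `[-T, T] × SU(n)^E` this is the backward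
continuity equation `∂_s U + Z_s·∇U + (div Z_s) U = 0`. [cite: Luscher2010Trivializing, §3.2 eqs. (3.4)–(3.9)] -/
theorem fderiv_transportFn_apply_one_cutField (hZ2 : ContDiff ℝ 2 fun p : ℝ × AmbConfig d L n => Z p.1 p.2)
    {O : AmbConfig d L n → ℝ} (hO : ContDiff ℝ 1 O)
    (s : ℝ) (W : AmbConfig d L n) :
    fderiv ℝ (transportFn B hZ1 T t₀ O) (s, W) ((1 : ℝ), cutField Z T (s, W)) =
      -cutDiv B Z T (s, W) * transportFn B hZ1 T t₀ O (s, W) := by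
  -- the flow line through `(s, W)` in `ℝ × M_n(ℂ)^E` and its velocity at `σ = 0`
  have hq : HasDerivAt (fun σ : ℝ => ((s + σ, cutFlow hZ1 T s (s + σ) W) : ℝ × AmbConfig d L n))
      ((1 : ℝ), cutField Z T (s, W)) 0 := by
    have h1 : HasDerivAt (fun σ : ℝ => s + σ) 1 0 := by simpa using (hasDerivAt_id (0 : ℝ)).const_add s
    have h2 : HasDerivAt (fun σ : ℝ => cutFlow hZ1 T s (s + σ) W)
        (cutField Z T (s + 0, cutFlow hZ1 T s (s + 0) W)) 0 := by
      have h := hasDerivAt_cutFlow hZ1 T s W (s + 0)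
      exact h.comp_const_add s 0
    rw [add_zero, cutFlow_self] at h2
    exact h1.prodMk h2
  -- left-hand side: chain rule
  have hL : HasDerivAt (fun σ : ℝ => transportFn B hZ1 T t₀ O (s + σ, cutFlow hZ1 T s (s + σ) W))
      (fderiv ℝ (transportFn B hZ1 T t₀ O) (s, W) ((1 : ℝ), cutField Z T (s, W))) 0 := by
    have hd : HasFDerivAt (transportFn B hZ1 T t₀ O) (fderiv ℝ (transportFn B hZ1 T t₀ O) (s, W))
        (s + 0, cutFlow hZ1 T s (s + 0) W) := by
      rw [add_zero, cutFlow_self]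
      exact ((contDiff_transportFn B hZ1 T t₀ hZ2 hO).differentiable one_ne_zero _).hasFDerivAt
    exact hd.comp_hasDerivAt (0 : ℝ) hq
  -- right-hand side: fundamental theorem of calculus at the upper limit
  have hk := continuous_cutDiv_cutFlow B hZ1 T hZ2 s W
  have hR : HasDerivAt (fun σ : ℝ => transportFn B hZ1 T t₀ O (s, W) *
      Real.exp (-∫ r in s..s + σ, cutDiv B Z T (r, cutFlow hZ1 T s r W)))
      (transportFn B hZ1 T t₀ O (s, W) *
        (Real.exp (-∫ r in s..s + 0, cutDiv B Z T (r, cutFlow hZ1 T s r W)) *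
          -cutDiv B Z T (s + 0, cutFlow hZ1 T s (s + 0) W))) 0 := by
    have hI : HasDerivAt (fun u : ℝ => ∫ r in s..u, cutDiv B Z T (r, cutFlow hZ1 T s r W))
        (cutDiv B Z T (s + 0, cutFlow hZ1 T s (s + 0) W)) (s + 0) :=
      intervalIntegral.integral_hasDerivAt_right (hk.intervalIntegrable _ _)
        (hk.stronglyMeasurableAtFilter _ _) hk.continuousAt
    have hI' := (hI.comp_const_add s 0).neg.exp
    exact hI'.const_mul _
  rw [add_zero, cutFlow_self, intervalIntegral.integral_same, neg_zero, Real.exp_zero, one_mul] at hR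
  have heq : (fun σ : ℝ => transportFn B hZ1 T t₀ O (s + σ, cutFlow hZ1 T s (s + σ) W)) =
      fun σ => transportFn B hZ1 T t₀ O (s, W) *
        Real.exp (-∫ r in s..s + σ, cutDiv B Z T (r, cutFlow hZ1 T s r W)) :=
    funext fun σ => transportFn_flowLine B hZ1 T t₀ hZ2 O s W σ
  rw [heq] at hL
  have := hL.unique hR
  rw [this]
  ring

end Transport

end Summit.Ventures.LatticeQCDFlow.TrivializingMaps

end
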